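import Mathlib.Probability.Distributions.Gaussian.Multivariate
import Mathlib.MeasureTheory.Measure.Tilted
import Mathlib.Analysis.Calculus.Gradient.Basic
import Mathlib.Analysis.Calculus.ContDiff.Basic
import Mathlib.MeasureTheory.Integral.IntervalIntegral.Basic
import HarnessLib

/-!
# The multiscale Bakry–Émery criterion for the logarithmic Sobolev inequality
# (Bauerschmidt–Bodineau; Polchinski renormalised potentials), finite-dimensional form

Topic `Literature/Analysis/FunctionSpaces` (companion, in subject, of `UniformlyConvexLogSobolev.lean`, which
PROVES the classical Bakry–Émery criterion `Hess V ≥ λ ⟹ LS(1/λ)` on `ℝⁿ`, `logSobolev_of_uniformlyConvex`; the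
criterion typed here is its MULTISCALE generalisation: convexity is asked of the renormalised potentials
`V_t` along a Polchinski flow, scale by scale, instead of `V₀`).  Requested by cell `ym-ir` (census row B16 of
`pub/ym-ir/REDUCTION-CENSUS.md`: «the one printed X ⇒ uniform log-Sobolev technology aimed beyond the convex
window; the CRITERION is typed-able and not circular»).  A CRITERION: no lattice-gauge instance exists in print
(the survey's instances are sine-Gordon, `φ⁴₂,₃`, Ising-type models); nothing here is a statement about
Yang–Mills.

Source (held, read this session; locators = page files of the materialised text `paper:arxiv-2307.07619`):
R. Bauerschmidt, T. Bodineau, B. Dagallier, *Stochastic dynamics and the Polchinski equation: an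
introduction*, Probab. Surveys 21 (2024) 200–290, arXiv:2307.07619 [BBD]: Def 1 (log-Sobolev inequality,
normalisation `Ent_ν(F) ≤ (2/γ) D_ν(√F)`) p0007 L85–91; §3.1 Gaussian integration, covariance decompositions
`C_∞ = ∫₀^∞ Ċ_t dt`, the forms `(u,v)_C = Σ C_ij u_i v_j` p0012; §3.2 (e:nu0-Cinfty) `E_{ν₀}[F] ∝
E_{C_∞}[e^{−V₀} F]`, Def 2 (renormalised potential `V_t`, Polchinski semigroup `P_{s,t}`, renormalised measure
`ν_t`) p0013 L20–45; §3.3 continuity assumption (e:continuity) p0015 L55–60 and **Theorem 3** (multiscale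
Bakry–Émery criterion) p0015 L62–90, Remarks 1–3 p0015 L96 – p0016 L12 (the criterion is that of
R. Bauerschmidt, T. Bodineau, *Log-Sobolev inequality for the continuum sine-Gordon model*, Comm. Pure Appl.
Math. 74 (2021) 2064–2113, [BBD]'s [MR4303014]). [cite: BauerschmidtBodineauDagallier2023]

## The printed statement ([BBD] Theorem 3)

Setting (§3.1–3.2): `t ↦ Ċ_t` bounded, positive semidefinite `N × N` matrices, `C_t = ∫₀^t Ċ_s ds`,
`C_∞ = ∫₀^∞ Ċ_s ds`; `ν₀` the probability measure `E_{ν₀}[F] ∝ E_{C_∞}[e^{−V₀(ζ)} F(ζ)]` with `V₀` bounded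
below; `V_t(φ) = −log E_{C_t}[e^{−V₀(φ+ζ)}]`, `P_{s,t}F(φ) = e^{V_t(φ)} E_{C_t−C_s}[e^{−V_s(φ+ζ)} F(φ+ζ)]`,
`E_{ν_t}[F] = e^{V_∞(0)} E_{C_∞−C_t}[e^{−V_t(ζ)} F(ζ)]`.  «Theorem 3.  Consider a measure `ν₀` of the form
(e:nu0-Cinfty) associated with a covariance decomposition `Ċ_t` differentiable for all `t`, and assume also
(e:continuity) [`lim_{t→∞} E_{ν_t}[g(P_{0,t}F)] = g(E_{ν₀}[F])` for all bounded smooth `F`, `g`].  Suppose there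
are real numbers `λ̇_t` (allowed to be negative) such that `∀ φ ∈ X, t > 0: Ċ_t Hess V_t(φ) Ċ_t − ½ C̈_t ≥ λ̇_t
Ċ_t`, and define `λ_t = ∫₀^t λ̇_s ds`, `1/γ = ∫₀^∞ e^{−2λ_t} dt`.  Then `ν₀` satisfies the log-Sobolev
inequality `Ent_{ν₀}[F] ≤ (2/γ) E_{ν₀}[(∇√F)²_{Ċ₀}]`.»

## Rendering (finite-dimensional, `X = ℝ^N`)

* `Polchinski.CovDecomposition N`: the data `C_t, Ċ_t, C̈_t, C_∞` as matrices with ENTRYWISE derivative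
  hypotheses on `[0, ∞)` (`C_0 = 0`, `d/dt C_t = Ċ_t`, `d/dt Ċ_t = C̈_t` — [BBD]'s «`Ċ_t` differentiable for all
  `t`»), `Ċ_t` positive semidefinite and bounded, `C_t → C_∞` entrywise (`C_∞ = ∫₀^∞ Ċ`).
* Gaussian measures are Mathlib's `ProbabilityTheory.multivariateGaussian 0 C` on `EuclideanSpace ℝ (Fin N)`;
  `ν₀ = (multivariateGaussian 0 C_∞).tilted (−V₀)` (`Polchinski.nu0`); `Polchinski.renormPotential` = `V_t`,
  `Polchinski.semigroup` = `P_{s,t}`, `Polchinski.renormExpect t F` = `E_{ν_t}[F]` (Def 2, as real-valued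
  functionals — `ν_t` is only used through its expectations).
* `Hess V_t(φ)` is the second Fréchet derivative `iteratedFDeriv ℝ 2 (V_t) φ`; the form inequality
  `Ċ Hess V_t Ċ − ½ C̈ ≥ λ̇ Ċ` is typed by testing on vectors: `Hess V_t(φ)(Ċv, Ċv) − ½ ⟨v, C̈v⟩ ≥ λ̇ ⟨v, Ċv⟩`
  (`Ċ` symmetric); matrices act through `Matrix.toEuclideanLin`.
* The conclusion is typed on the tree's test class (as in `UniformlyConvexLogSobolevDomain.HasLogSobolevC1c`,
  Bakry–Gentil–Ledoux Def. 5.1.1): for `f ∈ C¹_c(ℝ^N)` and `F = f²`,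
  `∫ f² log f² dν₀ − (∫ f² dν₀) log ∫ f² dν₀ ≤ 2 (∫₀^∞ e^{−2λ_t} dt) ∫ ⟨∇f, Ċ₀ ∇f⟩ dν₀`; since `(∇√F)²_{Ċ₀} =
  (∇|f|)²_{Ċ₀} ≤ (∇f)²_{Ċ₀}` wherever `|f|` is differentiable (and Lebesgue-a.e.), the typed right-hand side
  dominates the printed one: the typed inequality is implied by the printed theorem (equal for `ν₀ ≪`
  Lebesgue).
* WEAKENINGS (explicit extra hypotheses, so that junk values of `log`/`iteratedFDeriv` cannot make the
  hypotheses spuriously satisfiable): `V₀` measurable and bounded below (printed); `V_t ∈ C²` for `t > 0`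
  (implicit in the printed Hessian); `λ̇` locally integrable with `λ_t = ∫₀^t λ̇`; `∫₀^∞ e^{−2λ_t} dt < ∞`
  (finiteness of `1/γ`, implicit); the multiscale condition is asked for ALL `φ ∈ ℝ^N` ([BBD]: `φ ∈ X = im C_∞`;
  stronger hypothesis, weaker fact).
  -- TODO(general form): `X` a proper linear subspace (degenerate `C_∞`) with `φ ∈ X` only; non-differentiable
  --   `Ċ_t` ([BBD] Remark 3 = BB21); the Riemannian / compact-fibre form [BBD] Theorem 4 p0021 (the shape a
  --   gauge-covariant flow would need; «we currently do not know of any interesting applications» p0021 L31).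
* Library fit.  USED: Mathlib `multivariateGaussian`, `Measure.tilted`, `iteratedFDeriv`, `gradient`,
  `Matrix.toEuclideanLin`, `Matrix.PosSemidef`, interval integrals.  NOT restated: the classical criterion
  (`logSobolev_of_uniformlyConvex`, PROVED in the tree) — [BBD] p0015 L90: «in the case of convex potential
  `V₀`, the convexity is preserved by the Polchinski equation and the Bakry–Émery criterion can be recovered».
  No Polchinski-flow vocabulary for measures on `ℝ^N` exists in the tree (`lean search`: the tree's
  `GrassmannPolchinskiEquation` is the fermionic/Grassmann algebra RGE, a different object).
-/

noncomputable section

open MeasureTheory ProbabilityTheory Filter Topology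
open scoped RealInnerProductSpace ContDiff MatrixOrder Matrix

namespace Literature.Analysis.FunctionSpaces

namespace Polchinski

variable {N : ℕ}

/-! ### Covariance decompositions ([BBD] §3.1) -/

/-- A **covariance decomposition** `C_∞ = ∫₀^∞ Ċ_t dt` on `ℝ^N` ([BBD] §3.1 p0012 L40–48, with the
differentiability of `Ċ_t` assumed in Theorem 3): `C_t = ∫₀^t Ċ_s ds` (`C_0 = 0`, `d/dt C_t = Ċ_t` entrywise
on `[0,∞)`), `d/dt Ċ_t = C̈_t`, each `Ċ_t` positive semidefinite and bounded uniformly in `t`, and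
`C_t → C_∞` as `t → ∞`. [cite: BauerschmidtBodineauDagallier2023, §3.1] -/
structure CovDecomposition (N : ℕ) where
  /-- `C_t`. -/
  C : ℝ → Matrix (Fin N) (Fin N) ℝ
  /-- `Ċ_t`. -/
  Cdot : ℝ → Matrix (Fin N) (Fin N) ℝ
  /-- `C̈_t`. -/
  Cddot : ℝ → Matrix (Fin N) (Fin N) ℝ
  /-- `C_∞ = ∫₀^∞ Ċ_t dt`. -/
  Cinf : Matrix (Fin N) (Fin N) ℝ
  C_zero : C 0 = 0
  hasDerivAt_C : ∀ t, 0 ≤ t → ∀ i j, HasDerivAt (fun s => C s i j) (Cdot t i j) t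
  hasDerivAt_Cdot : ∀ t, 0 ≤ t → ∀ i j, HasDerivAt (fun s => Cdot s i j) (Cddot t i j) t
  posSemidef_Cdot : ∀ t, 0 ≤ t → (Cdot t).PosSemidef
  bounded_Cdot : ∃ M : ℝ, ∀ t, 0 ≤ t → ∀ i j, |Cdot t i j| ≤ M
  tendsto_C : ∀ i j, Tendsto (fun t => C t i j) atTop (𝓝 (Cinf i j))

/-! ### Renormalised potential, Polchinski semigroup, renormalised measure ([BBD] Def 2) -/

variable (D : CovDecomposition N) (V₀ : EuclideanSpace ℝ (Fin N) → ℝ)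

/-- The starting measure `ν₀`: `E_{ν₀}[F] ∝ E_{C_∞}[e^{−V₀(ζ)} F(ζ)]` ([BBD] (e:nu0-Cinfty) p0013 L22–27), the
Gaussian measure of covariance `C_∞` tilted by `−V₀`. [cite: BauerschmidtBodineauDagallier2023, §3.2] -/
def nu0 : Measure (EuclideanSpace ℝ (Fin N)) :=
  (multivariateGaussian 0 D.Cinf).tilted fun ζ => -V₀ ζ

/-- The **renormalised potential** `V_t(φ) = −log E_{C_t}[e^{−V₀(φ+ζ)}]` ([BBD] Def 2 (e:V-def) p0013 L33–36;
`V_0 = V₀` since `C_0 = 0`). [cite: BauerschmidtBodineauDagallier2023, Definition 2] -/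
def renormPotential (t : ℝ) (φ : EuclideanSpace ℝ (Fin N)) : ℝ :=
  -Real.log (∫ ζ, Real.exp (-V₀ (φ + ζ)) ∂(multivariateGaussian 0 (D.C t)))

/-- `V_∞(φ) = −log E_{C_∞}[e^{−V₀(φ+ζ)}]` ([BBD] p0013 L47–53; `e^{V_∞(0)}` normalises `ν_t`).
[cite: BauerschmidtBodineauDagallier2023, Definition 2] -/
def renormPotentialInf (φ : EuclideanSpace ℝ (Fin N)) : ℝ :=
  -Real.log (∫ ζ, Real.exp (-V₀ (φ + ζ)) ∂(multivariateGaussian 0 D.Cinf))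

/-- The **Polchinski semigroup** `P_{s,t}F(φ) = e^{V_t(φ)} E_{C_t−C_s}[e^{−V_s(φ+ζ)} F(φ+ζ)]`
([BBD] Def 2 (e:P-def-bis) p0013 L37–40). [cite: BauerschmidtBodineauDagallier2023, Definition 2] -/
def semigroup (s t : ℝ) (F : EuclideanSpace ℝ (Fin N) → ℝ) (φ : EuclideanSpace ℝ (Fin N)) : ℝ :=
  Real.exp (renormPotential D V₀ t φ) *
    ∫ ζ, Real.exp (-renormPotential D V₀ s (φ + ζ)) * F (φ + ζ) ∂(multivariateGaussian 0 (D.C t - D.C s))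

/-- The expectation `E_{ν_t}[F] = e^{V_∞(0)} E_{C_∞−C_t}[e^{−V_t(ζ)} F(ζ)]` under the **renormalised measure**
`ν_t` ([BBD] Def 2 (e:nu-def-bis) p0013 L41–45). [cite: BauerschmidtBodineauDagallier2023, Definition 2] -/
def renormExpect (t : ℝ) (F : EuclideanSpace ℝ (Fin N) → ℝ) : ℝ :=
  Real.exp (renormPotentialInf D V₀ 0) *
    ∫ ζ, Real.exp (-renormPotential D V₀ t ζ) * F ζ ∂(multivariateGaussian 0 (D.Cinf - D.C t))

/-- The technical **continuity assumption** (e:continuity) ([BBD] p0015 L55–60): for all bounded smooth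
`F : ℝ^N → ℝ` and `g : ℝ → ℝ`, `E_{ν_t}[g(P_{0,t}F)] → g(E_{ν₀}[F])` as `t → ∞` («easily checked in all examples
of practical interest»). [cite: BauerschmidtBodineauDagallier2023, §3.3 (e:continuity)] -/
def ContinuityAssumption : Prop :=
  ∀ (F : EuclideanSpace ℝ (Fin N) → ℝ) (g : ℝ → ℝ), ContDiff ℝ ∞ F → (∃ B : ℝ, ∀ φ, |F φ| ≤ B) →
    ContDiff ℝ ∞ g → (∃ B : ℝ, ∀ y, |g y| ≤ B) →
      Tendsto (fun t : ℝ => renormExpect D V₀ t fun φ => g (semigroup D V₀ 0 t F φ)) atTop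
        (𝓝 (g (∫ φ, F φ ∂(nu0 D V₀))))

/-- The Hessian of `f` at `φ` as a quadratic form, `Hess f(φ)(u, u)` (second Fréchet derivative).
[cite: BauerschmidtBodineauDagallier2023, §3.3] -/
def hessQF (f : EuclideanSpace ℝ (Fin N) → ℝ) (φ u : EuclideanSpace ℝ (Fin N)) : ℝ :=
  iteratedFDeriv ℝ 2 f φ ![u, u]

/-- The **multiscale Bakry–Émery condition** (e:assCt-mon) with rates `λ̇_t` ([BBD] Theorem 3 p0015 L68–71):
for all `φ` and `t > 0`, `Ċ_t Hess V_t(φ) Ċ_t − ½ C̈_t ≥ λ̇_t Ċ_t` as quadratic forms, i.e. for every vector `v`,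
`Hess V_t(φ)(Ċ_t v, Ċ_t v) − ½ ⟨v, C̈_t v⟩ ≥ λ̇_t ⟨v, Ċ_t v⟩`.
[cite: BauerschmidtBodineauDagallier2023, Theorem 3 (e:assCt-mon)] -/
def MultiscaleCondition (lamdot : ℝ → ℝ) : Prop :=
  ∀ (φ : EuclideanSpace ℝ (Fin N)) (t : ℝ), 0 < t → ∀ v : EuclideanSpace ℝ (Fin N),
    lamdot t * ⟪v, Matrix.toEuclideanLin (D.Cdot t) v⟫ ≤
      hessQF (renormPotential D V₀ t) φ (Matrix.toEuclideanLin (D.Cdot t) v) -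
        (1 / 2) * ⟪v, Matrix.toEuclideanLin (D.Cddot t) v⟫

/-! ### Theorem 3: the multiscale Bakry–Émery criterion (named fact) -/

/-- **[BBD] Theorem 3 — the multiscale Bakry–Émery criterion for the log-Sobolev inequality**
(Bauerschmidt–Bodineau–Dagallier, Probab. Surveys 21 (2024), Theorem 3 p0015 L62–90; the criterion of
Bauerschmidt–Bodineau, CPAM 74 (2021)), finite-dimensional form on `X = ℝ^N`.  Let `C_∞ = ∫₀^∞ Ċ_t dt` be a
covariance decomposition with `Ċ_t` differentiable, `ν₀ ∝ e^{−V₀} dP_{C_∞}` with `V₀` measurable and bounded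
below, `V_t` the renormalised potentials (assumed `C²` for `t > 0`), and assume the continuity assumption
(e:continuity).  IF there are `λ̇_t ∈ ℝ` with `Ċ_t Hess V_t(φ) Ċ_t − ½ C̈_t ≥ λ̇_t Ċ_t` for all `φ` and
`t > 0`, and `λ_t = ∫₀^t λ̇_s ds` has `∫₀^∞ e^{−2λ_t} dt < ∞`, THEN `ν₀` satisfies the log-Sobolev inequality
with `1/γ = ∫₀^∞ e^{−2λ_t} dt` in the `Ċ₀`-metric: for every `f ∈ C¹_c(ℝ^N)`,
`Ent_{ν₀}(f²) ≤ 2 (∫₀^∞ e^{−2λ_t} dt) · E_{ν₀}[⟨∇f, Ċ₀ ∇f⟩]` (printed for `F = f² ≥ 0` with `(∇√F)²_{Ċ₀}`;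
see the module docstring).  «Contrary to the Bakry–Émery criterion, the initial potential `V₀` is not
required to be convex» (p0015 L88).  Named `Prop` fact (D-0014); no instance for gauge theories exists in
print. [cite: BauerschmidtBodineauDagallier2023, Theorem 3] -/
def BauerschmidtBodineau_multiscaleBakryEmery (N : ℕ) : Prop :=
  ∀ (D : CovDecomposition N) (V₀ : EuclideanSpace ℝ (Fin N) → ℝ) (lamdot lam : ℝ → ℝ),
    Measurable V₀ → (∃ b : ℝ, ∀ φ, b ≤ V₀ φ) →
    (∀ t, 0 < t → ContDiff ℝ 2 (renormPotential D V₀ t)) →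
    ContinuityAssumption D V₀ →
    MultiscaleCondition D V₀ lamdot →
    (∀ t, 0 ≤ t → IntervalIntegrable lamdot volume 0 t) →
    (∀ t, 0 ≤ t → lam t = ∫ s in (0 : ℝ)..t, lamdot s) →
    IntegrableOn (fun t => Real.exp (-2 * lam t)) (Set.Ioi 0) →
      ∀ f : EuclideanSpace ℝ (Fin N) → ℝ, ContDiff ℝ 1 f → HasCompactSupport f →
        ∫ φ, f φ ^ 2 * Real.log (f φ ^ 2) ∂(nu0 D V₀) -
            (∫ φ, f φ ^ 2 ∂(nu0 D V₀)) * Real.log (∫ φ, f φ ^ 2 ∂(nu0 D V₀)) ≤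
          2 * (∫ t in Set.Ioi (0 : ℝ), Real.exp (-2 * lam t)) *
            ∫ φ, ⟪gradient f φ, Matrix.toEuclideanLin (D.Cdot 0) (gradient f φ)⟫ ∂(nu0 D V₀)

/-! ### Bookkeeping (proved) -/

/-- At `t = 0` the Gaussian reference measure of the renormalised potential is the point mass at `0`
(`C_0 = 0`, and Mathlib's `multivariateGaussian 0 0` is the image of the standard Gaussian under the zero
map). [cite: BauerschmidtBodineauDagallier2023, Definition 2] -/
theorem multivariateGaussian_C_zero : multivariateGaussian 0 (D.C 0) = Measure.dirac 0 := by
  rw [D.C_zero, multivariateGaussian]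
  have h0 : CFC.sqrt (0 : Matrix (Fin N) (Fin N) ℝ) = 0 := CFC.sqrt_zero
  rw [h0, map_zero]
  have : (fun x : EuclideanSpace ℝ (Fin N) => (0 : EuclideanSpace ℝ (Fin N)) +
      (0 : EuclideanSpace ℝ (Fin N) →L[ℝ] EuclideanSpace ℝ (Fin N)) x) = fun _ => 0 := by
    funext x; simp
  rw [this, Measure.map_const, measure_univ, one_smul]

/-- `V_0 = V₀`: the renormalised potential at scale `0` is the bare potential ([BBD] Def 2 with `C_0 = 0`).
[cite: BauerschmidtBodineauDagallier2023, Definition 2] -/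
theorem renormPotential_zero (φ : EuclideanSpace ℝ (Fin N)) : renormPotential D V₀ 0 φ = V₀ φ := by
  unfold renormPotential
  rw [multivariateGaussian_C_zero, integral_dirac]
  simp

/-- The multiscale condition is monotone in the rates: smaller `λ̇_t` are implied.
[cite: BauerschmidtBodineauDagallier2023, Theorem 3 (e:assCt-mon)] -/
theorem MultiscaleCondition.mono {lamdot lamdot' : ℝ → ℝ} (h : MultiscaleCondition D V₀ lamdot)
    (hle : ∀ t, 0 < t → lamdot' t ≤ lamdot t) : MultiscaleCondition D V₀ lamdot' := by
  intro φ t ht v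
  refine le_trans ?_ (h φ t ht v)
  refine mul_le_mul_of_nonneg_right (hle t ht) ?_
  -- `⟨v, Ċ_t v⟩ ≥ 0` by positive semidefiniteness
  have hpsd := (D.posSemidef_Cdot t ht.le).dotProduct_mulVec_nonneg (WithLp.ofLp v)
  have key : ⟪v, Matrix.toEuclideanLin (D.Cdot t) v⟫ =
      star (WithLp.ofLp v) ⬝ᵥ (D.Cdot t *ᵥ WithLp.ofLp v) := by
    rw [EuclideanSpace.inner_eq_star_dotProduct, dotProduct_comm]
    rfl
  rw [key]
  exact hpsd

end Polchinski

end Literature.Analysis.FunctionSpaces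

end
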